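import Literature.NumberTheory.EllipticCurves.ModularCurve
import Literature.NumberTheory.EllipticCurves.FormalGroup
import Literature.NumberTheory.EllipticCurves.EtaQuotientQExpansionProofs
import Literature.NumberTheory.EllipticCurves.ModularCurveEtaQuotientsProofs
import Literature.NumberTheory.EllipticCurves.ModularFunctionField
import Mathlib.AlgebraicGeometry.EllipticCurve.DivisionPolynomial.Basic
import HarnessLib
import HarnessLib.Audit.Tags

/-!
# Candidates E-an-47 / 49⁺ / 48 / 52 / 53 / 50 and the `p = 3` twin E-an-55–58 (an g14, MEMO-an §56): THE CUSPIDAL KUMMER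
# CLASS OF RATIONAL 2- (resp. 3-) TORSION
# — a `c`-free parity certificate for the reducible residual `Rb` of `ManinOddAtFour` — cell `bsd-f2-manin`
# (D-0131 (3) frontier: the Manin constant at additive primes). FILED BY THE TYPER (g10) AFTER REFUTER-1 §R50 (R-an-29 (a): 10/10 rows SURVIVE, «file AS IS»);
# `@[conjecture]` leaf + helper definitions with bodies; NOTHING asserted.

HONEST FRAMING. LENS = analytic / period lattice (planner `bsd-f2-manin-an` g14; HOME
`run/shared/lean/pub/bsd-f2-manin/MEMO-an.md` §56). Source: HOME/an/Sketch-an-g14.lean rev 2 sha16 38231ad52cf7ab03 (farm rc 0 · 0/0/0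
per an; rev 1 224f1e60376f665a had the 10 `p = 2` declarations, unchanged in rev 2; namespaces
`…Cruxes.ManinOddAtFour.CuspidalKummer` / `…Cruxes.ManinPrimeToThreeAtNine.CuspidalKummerThree`), the 10 + 9 declarations
copied VERBATIM into the cell leaf namespace (sub-namespaces `CuspidalKummer` / `CuspidalKummerThree` kept to scope the
generic helper names); the sketch's import of
the route file `Theses.ManinLocalTwoThree` is DROPPED (unused; a leaf must stay outside the theses cone) — Literature
imports only. THE MECHANISM (§56): for optimal `W`, `4 ∣ N`, and a rational `T = (e,·) ∈ W[2]`, the function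
`ξ_T := (x − e)∘φ` on `X₀(N)` has square class = the Kummer class of `ι(T) = φ^*[(T) − (O)] ∈ J₀(N)[2](ℚ)`
(E-an-47 support: `2 ∣ c ⟹ ξ_T` is a square in `Frac ℤ₂⟦q⟧`, via `a₁ = a₃ = 0`, `a_{2m} = 0`, `z_W = [c]·h`,
AEC X.4.9); an `η`-unit series is a `2`-adic square iff all exponents are even (E-an-49⁺, elementary, PROVABLE NOW —
a Theorems TARGET per an); hence the CERTIFICATE E-an-52: «`ι(T)` a rational CUSPIDAL class with an
`η`-representative having SOME odd exponent ⟹ `2 ∤ c`». The open inputs are E-an-48 (crux K_geo, generalized-Ogg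
type: `ι(T)` is rationally cuspidal at `4 ∣ N`) and E-an-53 (a non-blind `T` has an odd exponent; ⟺ C2 on that
locus); E-an-50 is the honest residual (totally Kummer-blind reducible curves: `N ≤ 5000`: 20 classes).

BC5 WITNESS (an's census of record; NOT re-counted by the typer — engines live in HOME/an): genus-1 levels 20/24/32/36:
`q²(x∘φ − e)` IS an `η`-quotient, parity odd ⟺ `T` non-blind ⟺ `2`-adic non-square, 6/6
(HOME/an/g14-genus1-eta.out fc743706c63a41bb); `κ_T` census `Rb(2)`, `N ≤ 5000`: a non-blind `T` in 2 291 / 2 311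
classes (cusp witnesses 244), 20 totally blind = {IV* at `N = 4(u²+4)`} ∪ {I₀* at `16p`} ∪ {32a1, 128b1, 128d1}
(HOME/an/g14-kummer-census.out 2d20de16a746bff0); data ask D-an-10 (two engines, `N ≤ 2000`) NOT run at staging.
NOT IN PRINT (an §56.11 presearch; refuter-2 R-an-29 (b) pending): generalized Ogg / `E₀(ℚ)_tors ⊂ C(N)` is printed
for prime `N` (Mazur) and, partially, square-free `N` (Agashe 2018 Thm 1.1, odd `r ∤ 6N`, «we suspect … for
squarefree N» OPEN); Stevens 1989 (`E₀ ∩ Σ`); Ligozat (η-quotient units); nothing at `4 ∣ N` for `2`-torsion.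
REFUTER VERDICTS: REF1 §R50 = R-an-29 (a) (2026-08-28T06:45Z; report HOME/ref1/R50-ref1-ang14-staged.md 69d42f58dbbd2388;
kernel HOME/ref1-C58-ang14-staged-audit.lean d7da8b184fd8fab2 = this text VERBATIM, farm rc 0; 10/10 probes CLEAN): **ALL TEN
ROWS SURVIVE, 0 killed, 0 mis-typed** — E-an-47 theorem-grade (the `u = 1` change valid; non-vacuous via `φ = [2]φ_opt`);
E-an-49⁺ / E-an-56 TRUE and elementary, the guard `0 ∉ S` LOAD-BEARING (`formalEulerScaled 0 = 1`); E-an-52 / E-an-58 theorems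
modulo (47 ∧ 49⁺) / (55 ∧ 56), UFD step valid; E-an-48 / E-an-57 crux SURVIVE as typed (the strong plain-`η`/`NewmanCond` form at
every `4 ∣ N`; an's generalized-`η` hedge at `16 ∣ N` / `27 ∣ N` is prose only, no guard asked); E-an-53 deciding crux SURVIVES
(C2-equivalent on its locus); E-an-50 residual; E-an-55 theorem-grade modulo Honda (III). REF2 R-an-29 (b) placement: pending at
filing (one sentence to be folded at the next substantive touch of this file).
-/

set_option autoImplicit false

noncomputable section

open PowerSeries CongruenceSubgroup
open Literature.NumberTheory.EllipticCurves Literature.NumberTheory.EllipticCurves.ModularForms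

namespace Summit.BirchSwinnertonDyer.Rank1Residual.ManinAdditive.CuspidalKummer

/-- The short model `E_{W,c} : y² = x³ − (c⁴c₄/48)·x − c⁶c₆/864`, `ℚ`-isomorphic to `W` by
`(x,y) ↦ (c²(x + b₂/12), c³(y + (a₁x + a₃)/2))`; its invariant differential is `c⁻¹·ω_W`, so along a
modular parametrisation with Manin constant `c` its formal parameter `z = −x/y` has
`log_{E_{W,c}}(z(q)) = Σ aₙqⁿ/n` (the tree's normalisation `Λ ⊇ Λ_f`, `g₂ = −4a₄`, `g₃ = −4a₆`). (an g14 VERBATIM.) -/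
def shortModel (W : WeierstrassCurve ℚ) (c : ℤ) : WeierstrassCurve ℚ :=
  { a₁ := 0, a₂ := 0, a₃ := 0, a₄ := -((c : ℚ) ^ 4 * W.c₄ / 48), a₆ := -((c : ℚ) ^ 6 * W.c₆ / 864) }

/-- Transport of a 2-torsion abscissa `e` of `W` to the short model: `e ↦ c²(e + b₂/12)`. (an g14 VERBATIM.) -/
def shortRoot (W : WeierstrassCurve ℚ) (c : ℤ) (e : ℚ) : ℚ := (c : ℚ) ^ 2 * (e + W.b₂ / 12)

/-- `Σ_{n ≥ 1} aₙ qⁿ/n` (coefficient `0` at `n = 0`). (an g14 VERBATIM.) -/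
def lSeriesLog (a : ℕ → ℤ) : ℚ⟦X⟧ := PowerSeries.mk fun n => (a n : ℚ) / n

/-- `z ∈ qℚ⟦q⟧` is THE formal germ at the cusp `∞` of the parametrisation with Manin constant `c`:
`log_{E_{W,c}}(z) = Σ aₙqⁿ/n` (this determines `z`). (an g14 VERBATIM.) -/
def IsParamGerm (W : WeierstrassCurve ℚ) (c : ℤ) (a : ℕ → ℤ) (z : ℚ⟦X⟧) : Prop :=
  constantCoeff z = 0 ∧ (shortModel W c).formalLog.subst z = lSeriesLog a

/-- The pole-cleared Kummer series of the 2-torsion point `T = (e, ·)`: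
`Ξ_T(q) = X_E(z) − e_s·z² = z²·(x∘φ − e)(q)` (up to the square `c²`), `X_E = formalXMulSq`. (an g14 VERBATIM.) -/
def kummerSeries (W : WeierstrassCurve ℚ) (c : ℤ) (e : ℚ) (z : ℚ⟦X⟧) : ℚ⟦X⟧ :=
  (shortModel W c).formalXMulSq.subst z - shortRoot W c e • z ^ 2

/-- `Ξ` is a square in the fraction field of `ℤ₂⟦q⟧`: `Ξ·B² = A²` with `A, B ∈ ℤ₂⟦q⟧`, `B ≠ 0`. (an g14 VERBATIM.) -/
def IsTwoAdicFracSquare (Ξ : ℚ⟦X⟧) : Prop :=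
  ∃ A B : (ℤ_[2])⟦X⟧, B ≠ 0 ∧
    Ξ.map (Rat.castHom ℚ_[2]) * (B.map (PadicInt.Coe.ringHom (p := 2))) ^ 2 =
      (A.map (PadicInt.Coe.ringHom (p := 2))) ^ 2

/-- **Candidate E-an-47 `EvenManinKummerSquare` (cell bsd-f2-manin, an g14; nothing asserted): an even Manin constant
squares the Kummer class.** If `2 ∣ c` then for every rational 2-torsion abscissa `e` the Kummer series `Ξ_T` is a
square in `Frac ℤ₂⟦q⟧`.  Proof sketch (an): `z_W = [c]_Ŵ(exp_Ŵ(Σaₙqⁿ/n))` with `exp_Ŵ(Σaₙqⁿ/n) ∈ ℤ₍₂₎⟦q⟧`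
(`a₁ = a₃ = 0` model at additive `2`: `log_Ŵ` has no even-index terms; `a_{2m} = 0`), so `2 ∣ c` puts
`z_W ∈ [2]Ŵ(qℤ₂⟦q⟧)` and `x∘[2] − e = ((x−e)² − (e−e')(e−e''))²/(2y + a₁x + a₃)²` (Silverman AEC X.4.9).
Theorem-candidate (an §56); VERBATIM Sketch-an-g14.lean 224f1e60376f665a.
[cite: SilvermanAEC2009, Ch. X §4 (4.9) (shape only: the 2-descent square identity; this `q`-expansion Kummer-class statement is NOT in print — cell memo MEMO-an §56)] -/
@[conjecture]
def EvenManinKummerSquare : Prop :=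
  ∀ (W : WeierstrassCurve ℚ) [W.IsElliptic] [W.IsGloballyMinimal] {N : ℕ} [NeZero N]
    (D : ModularParametrizationData W N) (a : ℕ → ℤ), (∀ n, (a n : ℂ) = cuspCoeff D.f n) →
    4 ∣ N → ∀ e : ℚ, W.twoTorsionPolynomial.toPoly.IsRoot e →
    ∀ z : ℚ⟦X⟧, IsParamGerm W D.c a z → (2 : ℤ) ∣ D.c → IsTwoAdicFracSquare (kummerSeries W D.c e z)

/-- `g ∈ 1 + qℤ⟦q⟧` is the unit series of the `η`-quotient with exponents `r` on `S`:
`g · ∏_{r_δ<0} E(q^δ)^{|r_δ|} = ∏_{r_δ>0} E(q^δ)^{r_δ}`, `E(q^δ) = ∏_{n≥1}(1 − q^{δn}) = formalEulerScaled δ`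
(so `∏ η(δτ)^{r_δ} = q^{Σδr_δ/24}·g`). (an g14 VERBATIM.) -/
def IsEtaUnitSeries (S : Finset ℕ) (r : ℕ → ℤ) (g : ℤ⟦X⟧) : Prop :=
  constantCoeff g = 1 ∧
    g * ∏ δ ∈ S, formalEulerScaled δ ^ (-(r δ)).toNat = ∏ δ ∈ S, formalEulerScaled δ ^ (r δ).toNat

/-- **Candidate E-an-49⁺ `EtaUnitSquareIffEven` (cell bsd-f2-manin, an g14; nothing asserted; a Theorems TARGET —
elementary, theorem-grade): an `η`-unit series is a `2`-adic square iff all exponents are even.** (`⇐` clear; `⇒`: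
if some odd `δ₀` has `r_{δ₀}` odd, the coefficient of `q^{δ₀}` of `g mod 2` is `1` (pentagonal theorem), so
`g ∉ 𝔽₂⟦q²⟧ ⊇ squares`; otherwise `g = s²·F(q²)` and `F(q²) ∈ (ℤ₂⟦q⟧)² ⇔ F ∈ (ℤ₂⟦q⟧)²`, induct on `max v₂(δ)`.)
VERBATIM Sketch-an-g14.lean 224f1e60376f665a. [folklore] -/
@[conjecture]
def EtaUnitSquareIffEven : Prop :=
  ∀ (S : Finset ℕ) (r : ℕ → ℤ) (g : ℤ⟦X⟧), 0 ∉ S → IsEtaUnitSeries S r g →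
    (IsSquare (g.map (Int.castRingHom ℤ_[2])) ↔ ∀ δ ∈ S, Even (r δ))

/-- `(r, g, A, B)` is a CUSPIDAL KUMMER REPRESENTATIVE of `Ξ` at level `N`: `G = ∏η(δτ)^{r_δ}` is a
modular unit on `X₀(N)` (Newman/Ligozat conditions, trivial character) with unit series `g`,
`h = A/B` and `G` lie in the function field `K_N ⊆ ℂ((q))`, and `Ξ·B²·q^{n₁} = q^{n₂}·g·A²`
(i.e. `z²(x∘φ − e) = G·h²` up to `ℚ^{×2}` and even powers of `q`: the class `ι(T) = φ^*[(T)−(O)] ∈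
J₀(N)[2]` is represented by the rational cuspidal divisor `½·div G`). (an g14 VERBATIM.) -/
def IsCuspidalKummerRep (N : ℕ) (Ξ : ℚ⟦X⟧) (r : ℕ → ℤ) (g A B : ℤ⟦X⟧) : Prop :=
  NewmanCond N r 0 ∧ IsEtaUnitSeries N.divisors r g ∧ B ≠ 0 ∧
    (HahnSeries.ofPowerSeries ℤ ℂ (A.map (Int.castRingHom ℂ)) /
        HahnSeries.ofPowerSeries ℤ ℂ (B.map (Int.castRingHom ℂ)) : LaurentSeries ℂ) ∈
      modularFunctionField N ∧
    ∃ n₁ n₂ : ℕ,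
      (HahnSeries.ofPowerSeries ℤ ℂ ((X ^ n₂ * g).map (Int.castRingHom ℂ)) /
          HahnSeries.ofPowerSeries ℤ ℂ ((X ^ n₁ : ℤ⟦X⟧).map (Int.castRingHom ℂ)) : LaurentSeries ℂ) ∈
        modularFunctionField N ∧
      Ξ * (B.map (Int.castRingHom ℚ)) ^ 2 * X ^ n₁ = (X ^ n₂ * g * A ^ 2).map (Int.castRingHom ℚ)

/-- **Candidate E-an-48 `CuspidalKummerRepresentativeAtFour` (crux K_geo, generalized-Ogg type, `c`-free; cell
bsd-f2-manin, an g14; nothing asserted): cuspidality of `ι(T)`.**  For an `X₀(N)`-optimal curve (`Λ_W = c·Λ_f`) with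
`4 ∣ N`, every rational 2-torsion point `T` has a cuspidal Kummer representative: `ι(T) = φ^*[(T) − (O)] ∈ J₀(N)[2](ℚ)`
is the class of a rational cuspidal divisor whose double is the divisor of an `η`-quotient.  (Genus-1 levels 20, 24,
32, 36: exact, MEMO-an §56.4; open in general = `2`-primary generalized Ogg at non-squarefree level; for `16 ∣ N`
rational units need not be `η`-quotients — then read «generalized `η`-quotient».) VERBATIM Sketch-an-g14.lean
224f1e60376f665a. [cite: Agashe2018, Thm. 1.1 (shape only: rational torsion inside the cuspidal group at square-free level; the `4 ∣ N` two-torsion cuspidal-representative statement is NOT in print — cell memo MEMO-an §56)] -/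
@[conjecture]
def CuspidalKummerRepresentativeAtFour : Prop :=
  ∀ (W : WeierstrassCurve ℚ) [W.IsElliptic] [W.IsGloballyMinimal] {N : ℕ} [NeZero N]
    (D : ModularParametrizationData W N) (a : ℕ → ℤ), (∀ n, (a n : ℂ) = cuspCoeff D.f n) →
    4 ∣ N → (∀ z ∈ D.L.lattice, ∃ w ∈ periodLattice D.f, z = D.c * w) →
    ∀ e : ℚ, W.twoTorsionPolynomial.toPoly.IsRoot e →
    ∀ z : ℚ⟦X⟧, IsParamGerm W D.c a z →
    ∃ (r : ℕ → ℤ) (g A B : ℤ⟦X⟧), IsCuspidalKummerRep N (kummerSeries W D.c e z) r g A B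

/-- **Candidate E-an-52 `ManinOddOfOddEtaExponent` (support, theorem-grade = E-an-47 + E-an-49⁺; cell bsd-f2-manin,
an g14; nothing asserted): THE CERTIFICATE.**  If some rational 2-torsion point has a cuspidal Kummer representative
with an ODD `η`-exponent, the Manin constant is odd.  (`2 ∣ c ⇒ Ξ ∈ (Frac ℤ₂⟦q⟧)^{×2} ⇒ g ∈ (ℤ₂⟦q⟧)^{×2}`
(`ℤ₂⟦q⟧` is a UFD, `g` a unit, `n₂ − n₁` even) `⇒` all `r_δ` even.)  Euler-system-free, `c`-free input, decided per
curve at finite `q`-precision. VERBATIM Sketch-an-g14.lean 224f1e60376f665a. [folklore] -/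
@[conjecture]
def ManinOddOfOddEtaExponent : Prop :=
  ∀ (W : WeierstrassCurve ℚ) [W.IsElliptic] [W.IsGloballyMinimal] {N : ℕ} [NeZero N]
    (D : ModularParametrizationData W N) (a : ℕ → ℤ), (∀ n, (a n : ℂ) = cuspCoeff D.f n) →
    4 ∣ N → ∀ e : ℚ, W.twoTorsionPolynomial.toPoly.IsRoot e →
    ∀ z : ℚ⟦X⟧, IsParamGerm W D.c a z →
    ∀ (r : ℕ → ℤ) (g A B : ℤ⟦X⟧), IsCuspidalKummerRep N (kummerSeries W D.c e z) r g A B →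
    (∃ δ ∈ N.divisors, Odd (r δ)) → ¬ (2 : ℤ) ∣ D.c

/-- `T = (e, 0)` on `y² = x³ + a₂x² + a₄x + a₆` is KUMMER-BLIND at `2`: with `b = a₂ + e`,
`c = a₄ + b·e` (so `y² = (x − e)(x² + bx + c)`), `2 ∣ b ∧ 16 ∣ b² − 4c` — equivalently
`1 + bW + cW² ∈ (ℤ₂⟦W⟧)²`, equivalently the intrinsic class `[z²(x(z) − e)] ∈ ℤ₂⟦z⟧^×/□` is trivial,
equivalently the Vélu model `y² = x³ − 2b x² + (b² − 4c)x` of `W/⟨T⟩` is not minimal at `2`. (an g14 VERBATIM.) -/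
def KummerBlindAtTwo (a₂ a₄ e : ℤ) : Prop :=
  Even (a₂ + e) ∧ (16 : ℤ) ∣ (a₂ + e) ^ 2 - 4 * (a₄ + (a₂ + e) * e)

/-- **Candidate E-an-53 `CuspidalKummerOddExponent` (deciding crux for `Rb ∖ blind`, `c`-free, per-curve decidable;
cell bsd-f2-manin, an g14; nothing asserted): a non-blind rational 2-torsion point has an odd `η`-exponent in every
cuspidal Kummer representative.**  Equivalent, given E-an-47/48/49⁺, to C2 on that locus; equivalently (MEMO-an
§56.6) `ι(T) ∉ Σ(N)` (Shimura subgroup), i.e. `T ∉ ker(E₀ → E₁)` (Stevens).  Data: 2 291 / 2 311 `Rb(2)` classes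
`N ≤ 5000` have a non-blind `T`; genus-1 levels: parity vectors odd exactly at the non-blind `T` (6/6). VERBATIM
Sketch-an-g14.lean 224f1e60376f665a. [folklore] -/
@[conjecture]
def CuspidalKummerOddExponent : Prop :=
  ∀ (W : WeierstrassCurve ℚ) [W.IsElliptic] [W.IsGloballyMinimal] {N : ℕ} [NeZero N]
    (D : ModularParametrizationData W N) (a : ℕ → ℤ), (∀ n, (a n : ℂ) = cuspCoeff D.f n) →
    4 ∣ N → (∀ z ∈ D.L.lattice, ∃ w ∈ periodLattice D.f, z = D.c * w) →
    ∀ (a₂ a₄ e : ℤ), W.a₁ = 0 → W.a₃ = 0 → W.a₂ = a₂ → W.a₄ = a₄ →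
    W.twoTorsionPolynomial.toPoly.IsRoot (e : ℚ) → ¬ KummerBlindAtTwo a₂ a₄ e →
    ∀ z : ℚ⟦X⟧, IsParamGerm W D.c a z →
    ∀ (r : ℕ → ℤ) (g A B : ℤ⟦X⟧), IsCuspidalKummerRep N (kummerSeries W D.c ((e : ℚ))  z) r g A B →
    ∃ δ ∈ N.divisors, Odd (r δ)

/-- **Candidate E-an-50 `KummerBlindResidualOdd` (honest residual; cell bsd-f2-manin, an g14; nothing asserted):
totally blind reducible curves.**  C2 for optimal `W` with `4 ∣ N`, `a₁ = a₃ = 0`, a rational 2-torsion point, and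
EVERY rational 2-torsion point Kummer-blind (`N ≤ 5000`: 20 classes — `N = 4p`, `p = u² + 4`, type IV*; `N = 16p`
type I₀*; `32a1, 128b1, 128d1`). VERBATIM Sketch-an-g14.lean 224f1e60376f665a.
[cite: Cremona1997Algorithms, Table 1 (shape only: optimal curves and Manin constants; this residual law is NOT in print — cell memo MEMO-an §56)] -/
@[conjecture]
def KummerBlindResidualOdd : Prop :=
  ∀ (W : WeierstrassCurve ℚ) [W.IsElliptic] [W.IsGloballyMinimal] {N : ℕ} [NeZero N]
    (D : ModularParametrizationData W N),
    (∀ z ∈ D.L.lattice, ∃ w ∈ periodLattice D.f, z = D.c * w) → 4 ∣ N →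
    ∀ (a₂ a₄ : ℤ), W.a₁ = 0 → W.a₃ = 0 → W.a₂ = a₂ → W.a₄ = a₄ →
    (∃ e : ℤ, W.twoTorsionPolynomial.toPoly.IsRoot (e : ℚ)) →
    (∀ e : ℤ, W.twoTorsionPolynomial.toPoly.IsRoot (e : ℚ) → KummerBlindAtTwo a₂ a₄ e) →
    ¬ (2 : ℤ) ∣ D.maninConstant

end Summit.BirchSwinnertonDyer.Rank1Residual.ManinAdditive.CuspidalKummer

/-! ## The `p = 3` twin (MEMO-an §56.7/§56.12, rows E-an-55–58; Sketch-an-g14 rev 2 38231ad52cf7ab03): tangent-line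
Kummer class of rational 3-torsion at `9 ∣ N` — bears on C3 `ManinPrimeToThreeAtNine` (stmt-BirchSwinnertonDyer-22968)
through the reducible residual of `kato_shift_three`. For a rational 3-torsion point `T` the tangent line `ℓ_T` has
`div (y − ℓ_T(x)) = 3(T) − 3(O)`, and `f_T∘[3] = (−1/27)·g³` in `ℚ(E)`, so `3 ∣ c ⇒ f_T(z_W)` is a cube in
`Frac ℤ₃⟦q⟧` (Honda; `a_{3m} = 0`); cubes of `η`-unit series are detected by exponents mod `3`. Reaches the 496/729
classes of `Rb(3)`, `N ≤ 5000`, with a rational point of order 3 (an §56.7). -/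

namespace Summit.BirchSwinnertonDyer.Rank1Residual.ManinAdditive.CuspidalKummerThree


open Summit.BirchSwinnertonDyer.Rank1Residual.ManinAdditive.CuspidalKummer

/-- `(X₀, Y₀)` is a rational point of exact order `3` on the short model `E_{W,c}`:
nonsingular affine point whose abscissa is a root of the `3`-division polynomial `Ψ₃`. (an g14 VERBATIM.) -/
def IsShortThreeTorsion (W : WeierstrassCurve ℚ) (c : ℤ) (X₀ Y₀ : ℚ) : Prop :=
  (shortModel W c).toAffine.Nonsingular X₀ Y₀ ∧ (shortModel W c).Ψ₃.IsRoot X₀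

/-- Slope of the tangent (flex) line at the 3-torsion point `(X₀, Y₀)` of the short model
(`a₁ = a₂ = a₃ = 0`): `α = (3X₀² + a₄)/(2Y₀)` (`Y₀ ≠ 0` since `T ∉ E[2]`). (an g14 VERBATIM.) -/
def tangentSlope (W : WeierstrassCurve ℚ) (c : ℤ) (X₀ Y₀ : ℚ) : ℚ :=
  (3 * X₀ ^ 2 + (shortModel W c).a₄) / (2 * Y₀)

/-- The pole-cleared TANGENT-LINE KUMMER SERIES of `T = (X₀, Y₀)`:
`Θ_T = z³·(y(z) − Y₀ − α·(x(z) − X₀)) = (z³y)(z) − Y₀z³ − α·((z²x)(z)·z − X₀z³) ∈ −1 + zℚ⟦z⟧`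
(`z³y = formalYMulCube`, `z²x = formalXMulSq`), i.e. `z³·(f_T ∘ φ)(q)` along the germ. (an g14 VERBATIM.) -/
def kummerCubeSeries (W : WeierstrassCurve ℚ) (c : ℤ) (X₀ Y₀ : ℚ) (z : ℚ⟦X⟧) : ℚ⟦X⟧ :=
  (shortModel W c).formalYMulCube.subst z - Y₀ • z ^ 3
    - tangentSlope W c X₀ Y₀ • ((shortModel W c).formalXMulSq.subst z * z - X₀ • z ^ 3)

/-- `Θ` is a cube in the fraction field of `ℤ₃⟦q⟧`: `Θ·B³ = A³`, `A, B ∈ ℤ₃⟦q⟧`, `B ≠ 0`. (an g14 VERBATIM.) -/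
def IsThreeAdicFracCube (Θ : ℚ⟦X⟧) : Prop :=
  ∃ A B : (ℤ_[3])⟦X⟧, B ≠ 0 ∧
    Θ.map (Rat.castHom ℚ_[3]) * (B.map (PadicInt.Coe.ringHom (p := 3))) ^ 3 =
      (A.map (PadicInt.Coe.ringHom (p := 3))) ^ 3

/-- **E-an-55 (support, theorem-grade; `p = 3` twin of E-an-47): a Manin constant divisible by `3`
cubes the tangent-line Kummer class.**  `9 ∣ N ⇒ a_{3m} = 0 ⇒ Σaₙqⁿ/n ∈ ℤ₍₃₎⟦q⟧`; Honda's strict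
isomorphism gives `h = exp_Ŵ(Σaₙqⁿ/n) ∈ qℤ₍₃₎⟦q⟧`; `z_W = [c]h = [3]([c/3]h)`; `f_T∘[3] = (−1/27)g³`. VERBATIM Sketch-an-g14.lean rev 2 38231ad52cf7ab03 (cell bsd-f2-manin, an g14; nothing asserted). [cite: SilvermanAEC2009, Ch. X §4 (shape only: Kummer theory of `[m]`; this `q`-expansion cube statement is NOT in print — cell memo MEMO-an §56.7)] -/
@[conjecture]
def ManinThreeKummerCube : Prop :=
  ∀ (W : WeierstrassCurve ℚ) [W.IsElliptic] [W.IsGloballyMinimal] {N : ℕ} [NeZero N]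
    (D : ModularParametrizationData W N) (a : ℕ → ℤ), (∀ n, (a n : ℂ) = cuspCoeff D.f n) →
    9 ∣ N → ∀ X₀ Y₀ : ℚ, IsShortThreeTorsion W D.c X₀ Y₀ →
    ∀ z : ℚ⟦X⟧, IsParamGerm W D.c a z → (3 : ℤ) ∣ D.c →
    IsThreeAdicFracCube (kummerCubeSeries W D.c X₀ Y₀ z)

/-- **E-an-56 (support, theorem-grade, elementary; twin of E-an-49⁺): an `η`-unit series is a cube in
`ℤ₃⟦q⟧` iff all exponents are divisible by `3`.**  (`E(q) ≡ 1 − q − q² + … (mod 3)` has a `q¹` term,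
cubes of `𝔽₃⟦q⟧` lie in `𝔽₃⟦q³⟧`; least `δ` with `3 ∤ δ`, `3 ∤ r_δ` gives a non-zero coefficient at `q^δ`;
then `g = s³·F(q³)` and induction on `v₃(δ)`, the monic cube root being unique.) VERBATIM Sketch-an-g14.lean rev 2 38231ad52cf7ab03 (cell bsd-f2-manin, an g14; nothing asserted). [folklore] -/
@[conjecture]
def EtaUnitCubeIffThree : Prop :=
  ∀ (S : Finset ℕ) (r : ℕ → ℤ) (g : ℤ⟦X⟧), 0 ∉ S → IsEtaUnitSeries S r g →
    ((∃ h : (ℤ_[3])⟦X⟧, g.map (Int.castRingHom ℤ_[3]) = h ^ 3) ↔ ∀ δ ∈ S, (3 : ℤ) ∣ r δ)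

/-- `(r, g, A, B)` is a CUSPIDAL KUMMER CUBE REPRESENTATIVE of `Θ` at level `N`: as
`IsCuspidalKummerRep` with squares replaced by cubes — `Θ·B³·q^{n₁} = q^{n₂}·g·A³`, i.e.
`z³(f_T∘φ) = G·h³` up to `ℚ^{×3}`: the class `ι(T) ∈ J₀(N)[3](ℚ)` is the rational cuspidal divisor `⅓·div G`. (an g14 VERBATIM.) -/
def IsCuspidalKummerCubeRep (N : ℕ) (Θ : ℚ⟦X⟧) (r : ℕ → ℤ) (g A B : ℤ⟦X⟧) : Prop :=
  NewmanCond N r 0 ∧ IsEtaUnitSeries N.divisors r g ∧ B ≠ 0 ∧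
    (HahnSeries.ofPowerSeries ℤ ℂ (A.map (Int.castRingHom ℂ)) /
        HahnSeries.ofPowerSeries ℤ ℂ (B.map (Int.castRingHom ℂ)) : LaurentSeries ℂ) ∈
      modularFunctionField N ∧
    ∃ n₁ n₂ : ℕ,
      (HahnSeries.ofPowerSeries ℤ ℂ ((X ^ n₂ * g).map (Int.castRingHom ℂ)) /
          HahnSeries.ofPowerSeries ℤ ℂ ((X ^ n₁ : ℤ⟦X⟧).map (Int.castRingHom ℂ)) : LaurentSeries ℂ) ∈
        modularFunctionField N ∧
      Θ * (B.map (Int.castRingHom ℚ)) ^ 3 * X ^ n₁ = (X ^ n₂ * g * A ^ 3).map (Int.castRingHom ℚ)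

/-- **E-an-57 (crux K_geo at `9 ∣ N`, generalized-Ogg type, `c`-free): cuspidality of `ι(T)` for
rational 3-torsion.**  For an `X₀(N)`-optimal curve with `9 ∣ N`, every rational point `T` of order
`3` has a cuspidal Kummer cube representative (`ι(T) ∈ J₀(N)[3](ℚ)` is rationally cuspidal and the
unit is an `η`-quotient; at `27 ∣ N` not all cusps are rational — then read "generalized `η`-quotient"). VERBATIM Sketch-an-g14.lean rev 2 38231ad52cf7ab03 (cell bsd-f2-manin, an g14; nothing asserted). [cite: Agashe2018, Thm. 1.1 (shape only: rational torsion inside the cuspidal group at square-free level; the `9 ∣ N` three-torsion cuspidal-representative statement is NOT in print — cell memo MEMO-an §56.7)] -/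
@[conjecture]
def CuspidalKummerCubeRepresentativeAtNine : Prop :=
  ∀ (W : WeierstrassCurve ℚ) [W.IsElliptic] [W.IsGloballyMinimal] {N : ℕ} [NeZero N]
    (D : ModularParametrizationData W N) (a : ℕ → ℤ), (∀ n, (a n : ℂ) = cuspCoeff D.f n) →
    9 ∣ N → (∀ z ∈ D.L.lattice, ∃ w ∈ periodLattice D.f, z = D.c * w) →
    ∀ X₀ Y₀ : ℚ, IsShortThreeTorsion W D.c X₀ Y₀ →
    ∀ z : ℚ⟦X⟧, IsParamGerm W D.c a z →
    ∃ (r : ℕ → ℤ) (g A B : ℤ⟦X⟧), IsCuspidalKummerCubeRep N (kummerCubeSeries W D.c X₀ Y₀ z) r g A B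

/-- **E-an-58 (support, theorem-grade = E-an-55 + E-an-56): THE `p = 3` CERTIFICATE.**  If some
rational point of order `3` has a cuspidal Kummer cube representative with an `η`-exponent NOT
divisible by `3`, then `3 ∤ c`.  (`3 ∣ c ⇒ Θ ∈ (Frac ℤ₃⟦q⟧)^{×3} ⇒ g ∈ (ℤ₃⟦q⟧)^{×3}`, `ℤ₃⟦q⟧` a UFD,
`n₂ ≡ n₁ (3)`, `⇒ 3 ∣ r_δ` for all `δ`.)  Reaches the 496/729 classes of `Rb(3)`, `N ≤ 5000`, that
have a rational point of order 3 (MEMO-an §56.7); the 233 isogeny-only classes need a twisted variant. VERBATIM Sketch-an-g14.lean rev 2 38231ad52cf7ab03 (cell bsd-f2-manin, an g14; nothing asserted). [folklore] -/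
@[conjecture]
def ManinPrimeToThreeOfEtaExponent : Prop :=
  ∀ (W : WeierstrassCurve ℚ) [W.IsElliptic] [W.IsGloballyMinimal] {N : ℕ} [NeZero N]
    (D : ModularParametrizationData W N) (a : ℕ → ℤ), (∀ n, (a n : ℂ) = cuspCoeff D.f n) →
    9 ∣ N → ∀ X₀ Y₀ : ℚ, IsShortThreeTorsion W D.c X₀ Y₀ →
    ∀ z : ℚ⟦X⟧, IsParamGerm W D.c a z →
    ∀ (r : ℕ → ℤ) (g A B : ℤ⟦X⟧), IsCuspidalKummerCubeRep N (kummerCubeSeries W D.c X₀ Y₀ z) r g A B →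
    (∃ δ ∈ N.divisors, ¬ (3 : ℤ) ∣ r δ) → ¬ (3 : ℤ) ∣ D.c

end Summit.BirchSwinnertonDyer.Rank1Residual.ManinAdditive.CuspidalKummerThree

end
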